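import Mathlib
import HarnessLib

/-!
# The exponential moment of a centred random variable: `∫ e^{−G} dP ≥ 1 + (∫|G| dP)²/8` when `∫ G dP = 0`, with equality to `1` iff `G` vanishes — the one-block floor of a free-energy fluctuation

HONEST FRAMING: exact (Metropolis-corrected) sampling algorithms for lattice gauge theory;
figures of merit are autocorrelation/cost numbers at stated couplings and volumes; no
continuum-physics claim.

Venture `LatticeQCDFlow` (cell pub-lqcd), topic `Exactness`; FANOUT row 7 (`s0-cpn-null`: the
S0-D1 rung — 2D CP⁹, Lüscher's LO trivializing map inside HMC, Engel–Schaefer 2011).  NEW WORK of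
the cell over Mathlib only; nothing is cited as a fact.  The inequality is elementary ([folklore]:
`e^{−x} − 1 + x ≥ x²/2` on `x ≤ 0`, Cauchy–Schwarz, and `∫ G⁻ = ½∫|G|` for a centred `G`); it is the
ONE-BLOCK INGREDIENT of the extensive floor for the reverse relative entropy of a flow sampler
(`Exactness/LatticeBlockEntropyFloor.lean`, `Exactness/SphereLOFlowEntropyFloor.lean`): the
relative entropy `KL(π̄ ‖ π̄.tilted(−F)) = log ∫ e^{−(F − ∫F)} dπ̄` of a sampler with log-weight `F` is
ZERO only if `F` is constant, and is at least `log(1 + (∫|F − ∫F|)²/8)` in general.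

## Content

* §1 `sq_negPart_div_two_le` — pointwise `(max (−x) 0)²/2 ≤ e^{−x} − 1 + x`;
  `abs_eq_self_add_two_mul_max_neg` — `|x| = x + 2·max (−x) 0`.
* §2 On a probability space: **`one_add_sq_integral_abs_div_eight_le_integral_exp_neg`** —
  `∫ G = 0 ⇒ 1 + (∫|G|)²/8 ≤ ∫ e^{−G}` (integrable `G`, `G²`, `e^{−G}`); the log form
  **`log_one_add_sq_integral_abs_le_log_integral_exp_neg`**; and the centred packaging
  **`log_integral_exp_neg_sub_mean_ge`** — `log ∫ e^{−(G − ∫G)} ≥ log(1 + (∫|G − ∫G|)²/8)` — for any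
  integrable `G` with `G²`, `e^{−G}` integrable.
* §3 Continuous functionals on a compact space with a probability measure of full support:
  **`integral_abs_sub_mean_pos_of_ne`** — if `G x ≠ G y` for some `x, y` then `0 < ∫|G − ∫G|`;
  **`log_integral_exp_neg_sub_mean_pos_of_ne`** — hence `0 < log ∫ e^{−(G − ∫G)}`: a non-constant
  continuous log-weight has STRICTLY POSITIVE relative entropy, quantified by its mean absolute
  deviation.

NOT CLAIMED: the sharp constant (the Gaussian value `Var/2` is not reached by this floor); anything
model-specific.
-/

noncomputable section

namespace Summit.Ventures.LatticeQCDFlow.Exactness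

open MeasureTheory Real Set Function

/-! ## §1 Pointwise inequalities -/

section Pointwise

/-- **`(max (−x) 0)²/2 ≤ e^{−x} − 1 + x`**: the convex function `e^{−x} − 1 + x ≥ 0` dominates half
the square of the negative part (`e^{y} ≥ 1 + y + y²/2` for `y ≥ 0`). -/
theorem sq_negPart_div_two_le (x : ℝ) : (max (-x) 0) ^ 2 / 2 ≤ Real.exp (-x) - 1 + x := by
  rcases le_or_gt 0 x with hx | hx
  · rw [max_eq_right (by linarith : -x ≤ 0)]
    have h := Real.add_one_le_exp (-x)
    nlinarith
  · rw [max_eq_left (by linarith : (0 : ℝ) ≤ -x)]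
    have h := Real.quadratic_le_exp_of_nonneg (x := -x) (by linarith)
    nlinarith

/-- `|x| = x + 2·max (−x) 0`. -/
theorem abs_eq_self_add_two_mul_max_neg (x : ℝ) : |x| = x + 2 * max (-x) 0 := by
  rcases le_or_gt 0 x with hx | hx
  · rw [abs_of_nonneg hx, max_eq_right (by linarith : -x ≤ 0)]; ring
  · rw [abs_of_neg hx, max_eq_left (by linarith : (0 : ℝ) ≤ -x)]; ring

/-- `max (−x) 0 ≤ |x|`. -/
theorem max_neg_zero_le_abs (x : ℝ) : max (-x) 0 ≤ |x| :=
  max_le (neg_le_abs x) (abs_nonneg x)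

end Pointwise

/-! ## §2 The floor on a probability space -/

section Floor

variable {Ω : Type*} [MeasurableSpace Ω] {P : Measure Ω} [IsProbabilityMeasure P]

/-- **THE EXPONENTIAL MOMENT OF A CENTRED VARIABLE: `1 + (∫|G| dP)²/8 ≤ ∫ e^{−G} dP`** whenever
`∫ G dP = 0` (with `G`, `G²`, `e^{−G}` integrable).  Proof: `∫ e^{−G} = 1 + ∫(e^{−G} − 1 + G) ≥
1 + ½∫(G⁻)² ≥ 1 + ½(∫G⁻)² = 1 + ½(½∫|G|)²`. -/
theorem one_add_sq_integral_abs_div_eight_le_integral_exp_neg {G : Ω → ℝ} (hG : Integrable G P)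
    (hG2 : Integrable (fun ω => G ω ^ 2) P) (hexp : Integrable (fun ω => Real.exp (-G ω)) P)
    (h0 : ∫ ω, G ω ∂P = 0) :
    1 + (∫ ω, |G ω| ∂P) ^ 2 / 8 ≤ ∫ ω, Real.exp (-G ω) ∂P := by
  -- the negative part `m = max (−G) 0`
  have hm_meas : AEStronglyMeasurable (fun ω => max (-G ω) 0) P :=
    (hG.aestronglyMeasurable.neg.sup aestronglyMeasurable_const)
  have hm_int : Integrable (fun ω => max (-G ω) 0) P := by
    refine Integrable.mono' hG.abs hm_meas (ae_of_all _ fun ω => ?_)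
    rw [Real.norm_eq_abs, abs_of_nonneg (le_max_right _ _)]
    exact max_neg_zero_le_abs (G ω)
  have hm2_int : Integrable (fun ω => (max (-G ω) 0) ^ 2) P := by
    refine Integrable.mono' hG2 (hm_meas.pow 2) (ae_of_all _ fun ω => ?_)
    rw [Real.norm_eq_abs, abs_of_nonneg (sq_nonneg _)]
    have h1 : 0 ≤ max (-G ω) 0 := le_max_right _ _
    have h2 : max (-G ω) 0 ≤ |G ω| := max_neg_zero_le_abs (G ω)
    calc (max (-G ω) 0) ^ 2 ≤ |G ω| ^ 2 := pow_le_pow_left₀ h1 h2 2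
      _ = G ω ^ 2 := sq_abs _
  -- (i) `∫|G| = 2 ∫ m`
  have habs : ∫ ω, |G ω| ∂P = 2 * ∫ ω, max (-G ω) 0 ∂P := by
    have e : ∀ ω, |G ω| = G ω + 2 * max (-G ω) 0 := fun ω => abs_eq_self_add_two_mul_max_neg (G ω)
    simp_rw [e]
    rw [integral_add hG (hm_int.const_mul 2), integral_const_mul, h0, zero_add]
  -- (ii) `(∫ m)² ≤ ∫ m²`
  have hjensen : (∫ ω, max (-G ω) 0 ∂P) ^ 2 ≤ ∫ ω, (max (-G ω) 0) ^ 2 ∂P := by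
    set a : ℝ := ∫ ω, max (-G ω) 0 ∂P with ha
    have hnn : 0 ≤ ∫ ω, (max (-G ω) 0 - a) ^ 2 ∂P := integral_nonneg fun ω => sq_nonneg _
    have hfun : (fun ω => (max (-G ω) 0 - a) ^ 2) =
        fun ω => (max (-G ω) 0) ^ 2 - 2 * a * max (-G ω) 0 + a ^ 2 := by
      funext ω; ring
    have hB : Integrable (fun ω => 2 * a * max (-G ω) 0) P := hm_int.const_mul _
    have hA : Integrable (fun ω => (max (-G ω) 0) ^ 2 - 2 * a * max (-G ω) 0) P := hm2_int.sub hB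
    have hC : Integrable (fun _ : Ω => a ^ 2) P := integrable_const _
    rw [hfun, integral_add hA hC, integral_sub hm2_int hB,
      integral_const_mul, integral_const, smul_eq_mul, probReal_univ, one_mul, ← ha] at hnn
    nlinarith
  -- (iii) `∫ e^{−G} = 1 + ∫ (e^{−G} − 1 + G) ≥ 1 + ½ ∫ m²`
  have hψ_int : Integrable (fun ω => Real.exp (-G ω) - 1 + G ω) P :=
    (hexp.sub (integrable_const 1)).add hG
  have hψ : ∫ ω, (max (-G ω) 0) ^ 2 / 2 ∂P ≤ ∫ ω, (Real.exp (-G ω) - 1 + G ω) ∂P :=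
    integral_mono (hm2_int.div_const 2) hψ_int fun ω => sq_negPart_div_two_le (G ω)
  have hsplit : ∫ ω, (Real.exp (-G ω) - 1 + G ω) ∂P = (∫ ω, Real.exp (-G ω) ∂P) - 1 := by
    have hA : Integrable (fun ω => Real.exp (-G ω) - 1) P := hexp.sub (integrable_const 1)
    have h1 : Integrable (fun _ : Ω => (1 : ℝ)) P := integrable_const 1
    rw [integral_add hA hG, integral_sub hexp h1,
      integral_const, smul_eq_mul, probReal_univ, one_mul, h0, add_zero]
  have hhalf : ∫ ω, (max (-G ω) 0) ^ 2 / 2 ∂P = (∫ ω, (max (-G ω) 0) ^ 2 ∂P) / 2 := by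
    rw [integral_div]
  rw [habs]
  rw [hsplit, hhalf] at hψ
  nlinarith [hjensen]

/-- **Log form**: `∫ G = 0 ⇒ log(1 + (∫|G|)²/8) ≤ log ∫ e^{−G}`. -/
theorem log_one_add_sq_integral_abs_le_log_integral_exp_neg {G : Ω → ℝ} (hG : Integrable G P)
    (hG2 : Integrable (fun ω => G ω ^ 2) P) (hexp : Integrable (fun ω => Real.exp (-G ω)) P)
    (h0 : ∫ ω, G ω ∂P = 0) :
    Real.log (1 + (∫ ω, |G ω| ∂P) ^ 2 / 8) ≤ Real.log (∫ ω, Real.exp (-G ω) ∂P) :=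
  Real.log_le_log (by positivity) (one_add_sq_integral_abs_div_eight_le_integral_exp_neg hG hG2 hexp h0)

/-- **THE CENTRED PACKAGING: `log ∫ e^{−(G − ∫G)} dP ≥ log(1 + (∫|G − ∫G| dP)²/8)`** for every
integrable `G` with `G²` and `e^{−G}` integrable — the relative entropy `KL(P ‖ P.tilted(−G))` of the
law `P` from its tilt by the log-weight `−G` is bounded below by the MEAN ABSOLUTE DEVIATION of `G`. -/
theorem log_integral_exp_neg_sub_mean_ge {G : Ω → ℝ} (hG : Integrable G P)
    (hG2 : Integrable (fun ω => G ω ^ 2) P) (hexp : Integrable (fun ω => Real.exp (-G ω)) P) :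
    Real.log (1 + (∫ ω, |G ω - ∫ ω', G ω' ∂P| ∂P) ^ 2 / 8) ≤
      Real.log (∫ ω, Real.exp (-(G ω - ∫ ω', G ω' ∂P)) ∂P) := by
  set m : ℝ := ∫ ω', G ω' ∂P with hm
  have hG' : Integrable (fun ω => G ω - m) P := hG.sub (integrable_const m)
  have hG2' : Integrable (fun ω => (G ω - m) ^ 2) P := by
    have hfun : (fun ω => (G ω - m) ^ 2) = fun ω => G ω ^ 2 - 2 * m * G ω + m ^ 2 := by
      funext ω; ring
    rw [hfun]
    exact (hG2.sub (hG.const_mul _)).add (integrable_const _)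
  have hexp' : Integrable (fun ω => Real.exp (-(G ω - m))) P := by
    have hfun : (fun ω => Real.exp (-(G ω - m))) = fun ω => Real.exp m * Real.exp (-G ω) := by
      funext ω; rw [← Real.exp_add]; congr 1; ring
    rw [hfun]
    exact hexp.const_mul _
  have h0 : ∫ ω, (G ω - m) ∂P = 0 := by
    rw [integral_sub hG (integrable_const m), integral_const, smul_eq_mul, probReal_univ, one_mul,
      hm, sub_self]
  exact log_one_add_sq_integral_abs_le_log_integral_exp_neg hG' hG2' hexp' h0

end Floor

/-! ## §3 Continuous functionals under a measure of full support: strict positivity -/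

section Positivity

variable {Ω : Type*} [TopologicalSpace Ω] [CompactSpace Ω] [MeasurableSpace Ω] [OpensMeasurableSpace Ω]
  {P : Measure Ω} [IsProbabilityMeasure P] [P.IsOpenPosMeasure]

/-- **A non-constant continuous functional has positive mean absolute deviation** under a probability
measure of full support on a compact space: `G x ≠ G y ⇒ 0 < ∫|G − ∫G| dP`. -/
theorem integral_abs_sub_mean_pos_of_ne {G : Ω → ℝ} (hG : Continuous G) {x y : Ω} (hxy : G x ≠ G y) :
    0 < ∫ ω, |G ω - ∫ ω', G ω' ∂P| ∂P := by
  set m : ℝ := ∫ ω', G ω' ∂P with hm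
  have hc : Continuous fun ω => |G ω - m| := (hG.sub continuous_const).abs
  have hi : Integrable (fun ω => |G ω - m|) P :=
    hc.integrable_of_hasCompactSupport (HasCompactSupport.of_compactSpace _)
  rw [integral_pos_iff_support_of_nonneg (fun ω => abs_nonneg _) hi]
  have hopen : IsOpen (Function.support fun ω => |G ω - m|) := hc.isOpen_support
  refine hopen.measure_pos P ?_
  -- one of `x`, `y` has `G ≠ m`
  by_cases hx : G x = m
  · refine ⟨y, ?_⟩
    rw [Function.mem_support, ne_eq, abs_eq_zero, sub_eq_zero]
    intro hy; exact hxy (hx.trans hy.symm)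
  · refine ⟨x, ?_⟩
    rw [Function.mem_support, ne_eq, abs_eq_zero, sub_eq_zero]
    exact hx

/-- **Hence a non-constant continuous log-weight has strictly positive relative entropy**:
`G x ≠ G y ⇒ 0 < log ∫ e^{−(G − ∫G)} dP` (compact `Ω`, full-support probability `P`). -/
theorem log_integral_exp_neg_sub_mean_pos_of_ne {G : Ω → ℝ} (hG : Continuous G) {x y : Ω}
    (hxy : G x ≠ G y) :
    0 < Real.log (∫ ω, Real.exp (-(G ω - ∫ ω', G ω' ∂P)) ∂P) := by
  have hGi : Integrable G P := hG.integrable_of_hasCompactSupport (HasCompactSupport.of_compactSpace _)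
  have hG2 : Integrable (fun ω => G ω ^ 2) P :=
    (hG.pow 2).integrable_of_hasCompactSupport (HasCompactSupport.of_compactSpace _)
  have hexp : Integrable (fun ω => Real.exp (-G ω)) P :=
    (Real.continuous_exp.comp hG.neg).integrable_of_hasCompactSupport
      (HasCompactSupport.of_compactSpace _)
  have hpos := integral_abs_sub_mean_pos_of_ne (P := P) hG hxy
  refine lt_of_lt_of_le ?_ (log_integral_exp_neg_sub_mean_ge hGi hG2 hexp)
  exact Real.log_pos (by nlinarith)

end Positivity

end Summit.Ventures.LatticeQCDFlow.Exactness

end
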